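import Mathlib
import HarnessLib

/-!
# Route `KLProgramme` — crux K3 ENGINE (stmt-HubbardSuperconductivity-20437 `KLRegimeEngineV17F2`), stub (b) v2, THE WEIGHTED HALF «(b)-WT4», ♯4 numerics:
# THE TWO DOMINATIONS OF THE SIX-LEG IMPORT NAME `ι₃` (cell gate-hubbard-kl, seat p4 g23)

♯4 (k3c3-p2 g18, pen (R416)(B)(2)/(R423)(C)/(R425)/(R426)(A)) replaces the six-leg plain import line of the weighted tower by a NAME `ι₃` under two dominations:
block 1's law member `W·Z³·(Ab·Qb³) ≤ ι₃` (p3's base law at `p = 3`) and the sectorised import amplitude of the blocks `k ≥ 2`, `W·Z³·y ≤ ι₃` (the (D1) free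
amplitude, `y = 16·S̃₆·(2M/β)⁵` when read off the input-family cell by `importRowSix_of_inputFamilyCell`).  The numerics glue numW4 pins
`ι₃ := 16·pZ³·(e + aT·qT³)·(M/β)⁵` (`W = 16`, `Z = pZ` by `levPinW_W/Z`; `Ab = aT·(β/M)/Bf²`, `Qb = Qtot₁ ≤ qT·(M/β)²` by `levNumW_group` (e)); this file proves
the two dominations as stand-alone inequalities (hoisted out of the ~190-binder context, where `nlinarith` exhausts the heartbeat budget):
* `levNumW_sixDom_import` — `y ≤ e·(M/β)⁵`, `0 ≤ aT, qT, pZ` ⟹ `W·Z³·y ≤ ι₃`;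
* `levNumW_sixDom_self` — the plain case `0 ≤ y`, `β ≤ M` ⟹ `y ≤ y·(M/β)⁵` (feeds the first with `e := y`);
* `levNumW_sixDom_base` — `Ab = aT·(β/M)/Bf²`, `0 ≤ Qb ≤ qT·(M/β)²`, `1 ≤ Bf`, `0 ≤ e` ⟹ `W·Z³·(Ab·Qb³) ≤ ι₃`.
Pure real arithmetic; nothing about the model is asserted; nothing asserts (b), any stub, K3 or superconductivity.
References: BGM 2006 §2.8 (2.77), (2.82)–(2.84) [cite: BenfattoGiulianiMastropietro2006].
-/

noncomputable section

namespace Summit.HubbardSuperconductivity.HubbardSuperconductivity.Theorems.EngineV8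

set_option linter.dupNamespace false -- summit = problem name (single-conjunct summit), D-0017

open Real

/-- **The six-leg name dominates the sectorised import amplitude**: `y ≤ e·(M/β)⁵` ⟹ `W·Z³·y ≤ ι₃` for `ι₃ = 16·pZ³·(e + aT·qT³)·(M/β)⁵`, `W = 16`, `Z = pZ`.
[cite: BenfattoGiulianiMastropietro2006, §2.8 (2.77), (2.82)-(2.84)] -/
theorem levNumW_sixDom_import {W Z pZ y e aT qT β x₆ ι₃ : ℝ} {M : ℕ} (hW : W = 16) (hZ : Z = pZ) (hpZ : 0 ≤ pZ) (haT : 0 ≤ aT) (hqT : 0 ≤ qT)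
    (hβ : 0 < β) (hy : y ≤ e * ((M : ℝ) / β) ^ 5) (hx₆ : x₆ = 16 * pZ ^ 3 * (e + aT * qT ^ 3)) (hι₃ : ι₃ = x₆ * ((M : ℝ) / β) ^ 5) :
    W * Z ^ 3 * y ≤ ι₃ := by
  rw [hι₃, hx₆, hW, hZ]
  have h16 : 0 ≤ 16 * pZ ^ 3 := by positivity
  have hr : 0 ≤ ((M : ℝ) / β) ^ 5 := by positivity
  have h1 : 16 * pZ ^ 3 * y ≤ 16 * pZ ^ 3 * (e * ((M : ℝ) / β) ^ 5) := mul_le_mul_of_nonneg_left hy h16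
  have h2 : e * ((M : ℝ) / β) ^ 5 ≤ (e + aT * qT ^ 3) * ((M : ℝ) / β) ^ 5 :=
    mul_le_mul_of_nonneg_right (le_add_of_nonneg_right (by positivity)) hr
  calc 16 * pZ ^ 3 * y ≤ 16 * pZ ^ 3 * (e * ((M : ℝ) / β) ^ 5) := h1
    _ ≤ 16 * pZ ^ 3 * ((e + aT * qT ^ 3) * ((M : ℝ) / β) ^ 5) := mul_le_mul_of_nonneg_left h2 h16
    _ = 16 * pZ ^ 3 * (e + aT * qT ^ 3) * ((M : ℝ) / β) ^ 5 := by ring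

/-- The plain case: `0 ≤ y`, `0 < β ≤ M` ⟹ `y ≤ y·(M/β)⁵`. -/
theorem levNumW_sixDom_self {y β : ℝ} {M : ℕ} (hy : 0 ≤ y) (hβ : 0 < β) (hβM : β ≤ M) : y ≤ y * ((M : ℝ) / β) ^ 5 := by
  have hr : (1 : ℝ) ≤ (M : ℝ) / β := by rw [le_div_iff₀ hβ, one_mul]; exact hβM
  calc y = y * 1 := (mul_one y).symm
    _ ≤ y * ((M : ℝ) / β) ^ 5 := mul_le_mul_of_nonneg_left (one_le_pow₀ hr) hy

/-- **The six-leg name dominates block 1's law member**: `W·Z³·(Ab·Qb³) ≤ ι₃` for `Ab = aT·(β/M)/Bf²`, `0 ≤ Qb ≤ qT·(M/β)²`, `1 ≤ Bf`, `0 ≤ e`,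
`ι₃ = 16·pZ³·(e + aT·qT³)·(M/β)⁵`, `W = 16`, `Z = pZ`. [cite: BenfattoGiulianiMastropietro2006, §2.8 (2.77), (2.82)-(2.84)] -/
theorem levNumW_sixDom_base {W Z pZ e aT qT β Bf Ab Qb x₆ ι₃ : ℝ} {M : ℕ} (hW : W = 16) (hZ : Z = pZ) (hpZ : 0 ≤ pZ) (he : 0 ≤ e) (haT : 0 ≤ aT)
    (hβ : 0 < β) (hβM : β ≤ M) (hBf : 1 ≤ Bf) (hAb : Ab = aT * (β / M) / Bf ^ 2) (hQb0 : 0 ≤ Qb) (hQb : Qb ≤ qT * ((M : ℝ) / β) ^ 2)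
    (hx₆ : x₆ = 16 * pZ ^ 3 * (e + aT * qT ^ 3)) (hι₃ : ι₃ = x₆ * ((M : ℝ) / β) ^ 5) :
    W * Z ^ 3 * (Ab * Qb ^ 3) ≤ ι₃ := by
  rw [hι₃, hx₆, hW, hZ]
  have hM0 : (0 : ℝ) < M := lt_of_lt_of_le hβ hβM
  have hBf0 : 0 < Bf := lt_of_lt_of_le one_pos hBf
  have hAb0 : 0 ≤ Ab := by rw [hAb]; positivity
  have hstep1 : Ab * Qb ^ 3 ≤ Ab * (qT * ((M : ℝ) / β) ^ 2) ^ 3 := mul_le_mul_of_nonneg_left (pow_le_pow_left₀ hQb0 hQb 3) hAb0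
  have hAb' : Ab ≤ aT * (β / M) := by
    rw [hAb, div_le_iff₀ (by positivity)]
    have : 0 ≤ aT * (β / ↑M) := by positivity
    nlinarith [one_le_pow₀ (n := 2) hBf]
  have hqT : 0 ≤ qT * ((M : ℝ) / β) ^ 2 := hQb0.trans hQb
  have hstep2 : Ab * (qT * ((M : ℝ) / β) ^ 2) ^ 3 ≤ aT * (β / M) * (qT * ((M : ℝ) / β) ^ 2) ^ 3 :=
    mul_le_mul_of_nonneg_right hAb' (by positivity)
  have heq : aT * (β / M) * (qT * ((M : ℝ) / β) ^ 2) ^ 3 = aT * qT ^ 3 * ((M : ℝ) / β) ^ 5 := by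
    field_simp
  have h16 : 0 ≤ 16 * pZ ^ 3 := by positivity
  calc 16 * pZ ^ 3 * (Ab * Qb ^ 3) ≤ 16 * pZ ^ 3 * (aT * qT ^ 3 * ((M : ℝ) / β) ^ 5) :=
      mul_le_mul_of_nonneg_left (hstep1.trans (hstep2.trans (le_of_eq heq))) h16
    _ ≤ 16 * pZ ^ 3 * (e + aT * qT ^ 3) * ((M : ℝ) / β) ^ 5 := by
      have : 0 ≤ ((M : ℝ) / β) ^ 5 := by positivity
      nlinarith [mul_nonneg h16 (mul_nonneg he this)]

end Summit.HubbardSuperconductivity.HubbardSuperconductivity.Theorems.EngineV8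

end
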